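import Literature.MathematicalPhysics.KineticTheory.HardSphereCollisionCampbell
import Literature.MathematicalPhysics.KineticTheory.HardSphereEulerProofs
import Literature.Analysis.FluidPDE.HardSphereFlowGroup
import Literature.Analysis.FluidPDE.HardSphereWindowCount
import Literature.Analysis.FluidPDE.HardSphereFlowMeasurable
import Summits.AtomisticToContinuum.HydrodynamicLimit.Theorems.LambertianContactSwapCollisionMomentBoundBridge
import Summits.AtomisticToContinuum.HydrodynamicLimit.Theorems.JParityClosureOddContactSymmetryGibbsInvariance
import HarnessLib

/-!
# Campbell's formula for `hit`-sums over Alexander's construction under the homogeneous Gibbs law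
# (sub-goal `stub_costCampbellHitSum` of stub `stub_cost`, line `Sketch`, crux
# `LambertianContactSwap.ContactAngleEquidistribution`, stmt-AtomisticToContinuum-12097)

The crux functional `A^V_N` of `ContactAngleEquidistribution` (and the collision moments of
`CollisionMomentBound`) is a MARKED HIT-SUM over the collision-by-collision construction of the
hard-sphere flow on `T³` (`Literature.Analysis.FluidPDE.HardSphereFlowConstruction`): the collisions in
`[0, t]` are enumerated as `m < Alexander.collisionCount z t`, the `m`-th one is read on the
PRE-collisional exit configuration `y_m = S_{τ(z_m)} z_m` (`z_m = Alexander.stateAfter z m`) through the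
selector `hit y i j = (i < j ∧ y ∈ contactSet i j ∧ IsIncoming y i j)`, and a mark `F (y_m, i, j)` of
the selected ordered pair is summed.  The first necessary condition of the equilibrium large-deviation
statement `stub_cost` is the equilibrium centring `E_Q A^V_N → 0`, whose first step is an EXACT formula
for the mean of such a hit-sum under the homogeneous Gibbs law `Q_N`: by the special flow
representation of Cercignani–Illner–Pulvirenti (1994, App. 4.A: "the Lebesgue measure becomes
`dσ dt`" on the collision cylinder) — equivalently Campbell's formula for the stationary point process
of collision instants — it is `t ×` a static integral of the mark over the contact hypersurface against
the flux measure `|n·(vᵢ − vⱼ)| dσ`.  That representation is the tree's named fact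
`Literature.MathematicalPhysics.KineticTheory.HardSphereCampbellFormula` (UNDISCHARGED; taken here as
the explicit hypothesis `hC`), stated for the trajectory collision sum
`Φ.collisionPairSum (Ioc 0 τ) g = ∑ᶠ_{s ∈ collisionTimes ∩ (0, τ]} Σ_{(i,j) ∈ contactPairs (Φ_s z)} g (Φ_s z) i j`
(marks read on the POST-collisional configuration, both orders of the colliding pair) and for laws with a
flow-invariant density (`HardSphereCampbellFormula.withDensity`).  This file supplies the generic,
reusable bridge and the resulting identity:

* `hitSum_eq_collisionPairSum` (pathwise, any regular Hausdorff geometry, any additive monoid of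
  values): for a hard-sphere trajectory `γ` and `t ≥ 0` the hit-sum of a mark `f` over Alexander's
  construction started at `γ 0` EQUALS the trajectory collision sum over the window `(0, t]` of the
  transported mark `g (w, i, j) = [i < j] f (collidePair i j w, i, j)` — the instants `t_{m+1}`,
  `m < collisionCount`, are exactly the collision times of `γ` in `(0, t]`
  (`IsHardSphereTrajectory.stateAfter_eq_apply`, `Alexander.FwdGood.mem_instantSet_of_fwdFlow_mem_contactSet`,
  `Alexander.le_collisionCount_iff`; `t_1 = τ(γ 0) > 0`), at each of them the `hit`-selected double sum is
  the single term of the colliding pair `i₀ < j₀` (`sum_sum_ite_hit_eq`) while `contactPairs` consists of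
  `(i₀, j₀), (j₀, i₀)` (`IsHardSphereTrajectory.contactPairs_eq_pair`), of which `[i < j]` keeps one, and
  the pre-collisional configuration is recovered from the post-collisional one by the involution
  `collidePair` (`collidePair_collidePair`);
* `hitSum_eq_collisionPairSum_flow`: the same along the orbit of a good datum of a hard-sphere flow;
* `lintegral_hitSum_localGibbsLaw_const` and the registered form `stub_costCampbellHitSum`
  (**Campbell for hit-sums**): on `T³` with `0 < σ < 1/2`, for every `N`, every hard-sphere flow
  structure `Φ`, every `t ≥ 0` and every measurable `ℝ≥0∞`-valued mark `F` of (pre-collisional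
  configuration, ordered pair),
  `∫⁻ Σ_{m < collisionCount z t} Σ_{i,j} [hit y_m i j] F (y_m, i, j) dQ_N(z)
     = ofReal t * outgoingCollisionFlux ε_N (N+1) (fun w i j => ρ_N(w) * [i < j] F (collidePair i j w, i, j))`,
  where `Q_N = localGibbsLaw σ 1 0 θ N Φ` is the homogeneous Gibbs law and
  `ρ_N = ofReal ∘ canonicalDensity … (localGibbsProfile 1 0 θ)` its (flow-invariant,
  `canonicalDensity_const_flow`) Liouville density `Z⁻¹ 1_D Πᵢ M_{1,0,θ}(vᵢ)`, inserted on the flux side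
  at the (outgoing) contact configuration.  No hypothesis on `θ` is needed.

Deliberately NOT here: time-dependent marks (the crux's `ψ` also reads the collision instant; that is a
Stieltjes refinement over sub-windows using stationarity), real-valued / centred marks (split
`F = F⁺ − F⁻`, both sides finite by `CollisionMomentBound`-type flux bounds), and any evaluation of the
static flux integral (the lead's `…Centring.lean`).

References: C. Cercignani, R. Illner, M. Pulvirenti, *The Mathematical Theory of Dilute Gases*,
Springer (1994), §4.2 and App. 4.A pp. 107–111; A. F. Karr, *Point Processes and Their Statistical
Inference* (1991), Prop. 1.63; I. Gallagher, L. Saint-Raymond, B. Texier, *From Newton to Boltzmann*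
(2013), §4.1.
-/

noncomputable section

open MeasureTheory Filter Set Topology Function
open scoped ENNReal BigOperators Classical

namespace Summit.AtomisticToContinuum.HydrodynamicLimit.Theorems.ContactAngleEquidistributionSketch

open Literature.Analysis.FluidPDE Literature.MathematicalPhysics.KineticTheory
open Summit.AtomisticToContinuum.HydrodynamicLimit.Theorems.LambertianContactSwapCollisionMomentBound

/-! ### The pathwise bridge: hit-sums over Alexander's construction are trajectory collision sums -/

section Pathwise

variable {d : Type*} [Fintype d] {X : Type*} {N : ℕ} {G : Geometry d X} {ε : ℝ}
  [TopologicalSpace X] [T2Space X]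

/-- **Hit-sums over Alexander's construction are trajectory collision sums (equality).**  Let `γ` be
a hard-sphere trajectory in a regular Hausdorff geometry and `t ≥ 0`; write `z = γ 0`,
`z_m = stateAfter z m`, `y_m = S_{τ(z_m)} z_m` (pre-collisional exit configurations).  For every mark
`f` with values in an additive commutative monoid,
`Σ_{m < collisionCount z t} Σ_{i,j} [i < j, y_m ∈ contactSet i j, incoming] f (y_m, i, j)
  = ∑ᶠ_{s ∈ collisionTimes γ ∩ (0, t]} Σ_{(i,j) ∈ contactPairs (γ s)} [i < j] f (collidePair i j (γ s), i, j)`: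
the instants `t_{m+1}`, `m < collisionCount z t`, are exactly the collision times of `γ` in `(0, t]`
(`t_1 = τ(γ 0) > 0`; contacts of the right-continuous orbit happen only at instants), at `t_{m+1}` the
orbit is at `z_{m+1} = collidePair i₀ j₀ y_m` for the unique incoming contact pair `i₀ < j₀` of `y_m`,
the ordered contact pairs there are `(i₀, j₀), (j₀, i₀)`, and `collidePair i₀ j₀` is an involution
(CIP 1994 App. 4.A: the boundary map `T = R⁻¹ ∘ φ_{a(y)}` of the special flow representation).
[cite: CIP1994, App. 4.A pp. 107–111] -/
theorem hitSum_eq_collisionPairSum {M : Type*} [AddCommMonoid M] (hG : G.IsHardSphereRegular ε)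
    {γ : ℝ → Config N d X} (hγ : IsHardSphereTrajectory G ε N γ) {t : ℝ} (ht : 0 ≤ t)
    (f : Config N d X → Fin N → Fin N → M) :
    (∑ m ∈ Finset.range (Alexander.collisionCount G ε (γ 0) t), ∑ i : Fin N, ∑ j : Fin N,
        (if i < j ∧
            freeFlight G (Alexander.freeExitTime G ε (Alexander.stateAfter G ε (γ 0) m)).toReal
                (Alexander.stateAfter G ε (γ 0) m) ∈ contactSet G N ε i j ∧
            IsIncoming G (freeFlight G (Alexander.freeExitTime G ε
                (Alexander.stateAfter G ε (γ 0) m)).toReal (Alexander.stateAfter G ε (γ 0) m)) i j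
          then f (freeFlight G (Alexander.freeExitTime G ε
                (Alexander.stateAfter G ε (γ 0) m)).toReal (Alexander.stateAfter G ε (γ 0) m)) i j
          else 0)) =
      collisionPairSum G ε γ (Ioc 0 t)
        (fun s i j => if i < j then f (collidePair G i j (γ s)) i j else 0) := by
  classical
  -- abbreviations: the count `K`, the exit configurations `Y m`, the instants `sm m = t_{m+1}`
  set K := Alexander.collisionCount G ε (γ 0) t with hKdef
  set Y : ℕ → Config N d X := fun m =>
    freeFlight G (Alexander.freeExitTime G ε (Alexander.stateAfter G ε (γ 0) m)).toReal
      (Alexander.stateAfter G ε (γ 0) m) with hYdef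
  have hYm : ∀ m, freeFlight G (Alexander.freeExitTime G ε (Alexander.stateAfter G ε (γ 0) m)).toReal
      (Alexander.stateAfter G ε (γ 0) m) = Y m := fun m => rfl
  simp only [hYm]
  set sm : ℕ → ℝ := fun m => (Alexander.collisionInstant G ε (γ 0) (m + 1)).toReal with hsmdef
  set g : ℝ → Fin N → Fin N → M := fun s i j => if i < j then f (collidePair G i j (γ s)) i j else 0
    with hgdef
  have hfinT : (collisionTimes G ε γ ∩ Ioc 0 t).Finite :=
    hγ.finite_collisionTimes_inter_of_subset_Icc Ioc_subset_Icc_self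
  rw [collisionPairSum_eq_finset_sum hfinT]
  -- the forward orbit of `γ 0` is forward-good; instants `t_{m+1}`, `m < K`, are finite and `≤ t`
  have hfwd : Alexander.FwdGood G ε (γ 0) := hγ.fwdGood_apply_zero hG
  have hle : ∀ m, m < K → Alexander.collisionInstant G ε (γ 0) (m + 1) ≤ ENNReal.ofReal t :=
    fun m hm => (Alexander.le_collisionCount_iff hfwd).1 (Nat.succ_le_of_lt hm)
  have hfin : ∀ m, m < K → Alexander.collisionInstant G ε (γ 0) (m + 1) ≠ ∞ :=
    fun m hm => ne_top_of_le_ne_top ENNReal.ofReal_ne_top (hle m hm)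
  have hst : ∀ m, m < K →
      Alexander.stateAfter G ε (γ 0) (m + 1) = γ (sm m) ∧ sm m ∈ collisionTimes G ε γ :=
    fun m hm => ⟨(hγ.stateAfter_eq_apply hG (hfin m hm)).1,
      (hγ.stateAfter_eq_apply hG (hfin m hm)).2 (Nat.succ_pos m)⟩
  have hτfin : ∀ m, m < K →
      Alexander.freeExitTime G ε (Alexander.stateAfter G ε (γ 0) m) ≠ ∞ := by
    intro m hm
    have h := hfin m hm
    rw [Alexander.collisionInstant_succ, ENNReal.add_ne_top] at h
    exact h.2
  -- the instants are positive: `t_{m+1} ≥ t_1 = τ(γ 0) > 0`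
  have hpos : ∀ m, m < K → 0 < sm m := by
    intro m hm
    refine ENNReal.toReal_pos (ne_of_gt ?_) (hfin m hm)
    calc (0 : ℝ≥0∞) < Alexander.freeExitTime G ε (γ 0) := hγ.freeExitTime_apply_pos hG 0
      _ = Alexander.collisionInstant G ε (γ 0) 1 := (Alexander.collisionInstant_one _).symm
      _ ≤ Alexander.collisionInstant G ε (γ 0) (m + 1) :=
          Alexander.monotone_collisionInstant _ (Nat.succ_le_succ (Nat.zero_le m))
  -- the instants are distinct
  have hlt_of_lt : ∀ m₁ m₂, m₂ < K → m₁ < m₂ → sm m₁ < sm m₂ := by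
    intro m₁ m₂ hm₂ h12
    have hmono : Alexander.collisionInstant G ε (γ 0) (m₁ + 1 + 1) ≤
        Alexander.collisionInstant G ε (γ 0) (m₂ + 1) :=
      Alexander.monotone_collisionInstant _ (by omega)
    have hfin₁ : Alexander.collisionInstant G ε (γ 0) (m₁ + 1) ≠ ∞ :=
      ne_top_of_le_ne_top (hfin m₂ hm₂)
        ((Alexander.monotone_collisionInstant _ (Nat.le_succ _)).trans hmono)
    have hlt : Alexander.collisionInstant G ε (γ 0) (m₁ + 1) <
        Alexander.collisionInstant G ε (γ 0) (m₂ + 1) :=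
      (hfwd.collisionInstant_lt_succ hG (Nat.succ_pos m₁) hfin₁).trans_le hmono
    exact (ENNReal.toReal_lt_toReal hfin₁ (hfin m₂ hm₂)).2 hlt
  have hinj : ∀ m₁ ∈ Finset.range K, ∀ m₂ ∈ Finset.range K, sm m₁ = sm m₂ → m₁ = m₂ := by
    intro m₁ hm₁ m₂ hm₂ heq
    rw [Finset.mem_range] at hm₁ hm₂
    rcases lt_trichotomy m₁ m₂ with h | h | h
    · exact absurd heq (hlt_of_lt m₁ m₂ hm₂ h).ne
    · exact h
    · exact absurd heq (hlt_of_lt m₂ m₁ hm₁ h).ne'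
  -- the instants `t_{m+1}`, `m < K`, are exactly the collision times of `γ` in `(0, t]`
  have himage : (Finset.range K).image sm = hfinT.toFinset := by
    ext s
    rw [Finset.mem_image, Set.Finite.mem_toFinset]
    constructor
    · rintro ⟨m, hm, rfl⟩
      rw [Finset.mem_range] at hm
      exact ⟨(hst m hm).2, hpos m hm, ENNReal.toReal_le_of_le_ofReal ht (hle m hm)⟩
    · rintro ⟨hs, hs0, hst'⟩
      obtain ⟨i, j, hij, hc⟩ := mem_collisionTimes.1 hs
      rw [← hγ.fwdFlow_apply_zero hG hs0.le] at hc
      obtain ⟨-, k, hk, hks⟩ := hfwd.mem_instantSet_of_fwdFlow_mem_contactSet hs0 hij hc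
      obtain ⟨m, rfl⟩ := Nat.exists_eq_succ_of_ne_zero hk.ne'
      refine ⟨m, Finset.mem_range.2 (Nat.lt_of_succ_le ((Alexander.le_collisionCount_iff hfwd).2 ?_)), ?_⟩
      · rw [hks]
        exact ENNReal.ofReal_le_ofReal hst'
      · show (Alexander.collisionInstant G ε (γ 0) (m + 1)).toReal = s
        rw [hks, ENNReal.toReal_ofReal hs0.le]
  -- at the `m`-th collision the `hit`-sum and the transported contact-pair sum agree
  have hkey : ∀ m, m < K →
      (∑ i : Fin N, ∑ j : Fin N,
        (if i < j ∧ Y m ∈ contactSet G N ε i j ∧ IsIncoming G (Y m) i j then f (Y m) i j else 0)) =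
      ∑ p ∈ contactPairs G ε (γ (sm m)), g (sm m) p.1 p.2 := by
    intro m hm
    obtain ⟨⟨i₀, j₀⟩, hp, heq⟩ := hfwd.exists_stateAfter_succ (hτfin m hm)
    have hp' : Alexander.IsSimpleIncomingWith G ε (Y m) (i₀, j₀) := hp
    have hij : i₀ ≠ j₀ := hp'.ne
    have hlt : i₀ < j₀ := hp'.1
    have heq' : γ (sm m) = collidePair G i₀ j₀ (Y m) := by rw [← (hst m hm).1]; exact heq
    rw [sum_sum_ite_hit_eq hp' f]
    have hpc : (i₀, j₀) ∈ contactPairs G ε (γ (sm m)) := by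
      rw [mem_contactPairs, heq']
      exact ⟨hij, (mem_contactSet_congr_fst fun k => collidePair_apply_fst (Y m) k).2
        hp'.mem_contactSet⟩
    have hne : (i₀, j₀) ≠ (j₀, i₀) := fun h => hij (Prod.mk.inj h).1
    rw [hγ.contactPairs_eq_pair hG hpc, Finset.sum_pair hne]
    simp only [hgdef, if_pos hlt, if_neg (not_lt.2 hlt.le), add_zero]
    rw [heq', collidePair_collidePair hij]
  -- summation over `m < K`, reindexed by the (distinct) instants
  calc (∑ m ∈ Finset.range K, ∑ i : Fin N, ∑ j : Fin N,
          (if i < j ∧ Y m ∈ contactSet G N ε i j ∧ IsIncoming G (Y m) i j then f (Y m) i j else 0))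
      = ∑ m ∈ Finset.range K, ∑ p ∈ contactPairs G ε (γ (sm m)), g (sm m) p.1 p.2 :=
        Finset.sum_congr rfl fun m hm => hkey m (Finset.mem_range.1 hm)
    _ = ∑ s ∈ (Finset.range K).image sm, ∑ p ∈ contactPairs G ε (γ s), g s p.1 p.2 :=
        (Finset.sum_image (f := fun s => ∑ p ∈ contactPairs G ε (γ s), g s p.1 p.2) hinj).symm
    _ = ∑ s ∈ hfinT.toFinset, ∑ p ∈ contactPairs G ε (γ s), g s p.1 p.2 := by rw [himage]

end Pathwise

/-! ### Along a hard-sphere flow -/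

section Flow

variable {d : Type*} [Fintype d] {X : Type*} {N : ℕ} {G : Geometry d X} {ε : ℝ}
  [MeasureSpace X] [TopologicalSpace X] [T2Space X]

/-- **The same identity along a hard-sphere flow.**  For any hard-sphere flow structure `Φ` in a
regular Hausdorff geometry, a good datum `z` (`s ↦ Φ_s z` is a hard-sphere trajectory with
`Φ_0 z = z`), `t ≥ 0` and any mark `f`, the hit-sum over Alexander's construction started at `z`
equals the collision pair sum `Φ.collisionPairSum (Ioc 0 t)` of the transported mark
`(w, i, j) ↦ [i < j] f (collidePair i j w, i, j)`. [cite: CIP1994, App. 4.A pp. 107–111] -/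
theorem hitSum_eq_collisionPairSum_flow {M : Type*} [AddCommMonoid M]
    (hG : G.IsHardSphereRegular ε) (Φ : HardSphereFlow G ε N) {z : Config N d X} (hz : z ∈ Φ.good)
    {t : ℝ} (ht : 0 ≤ t) (f : Config N d X → Fin N → Fin N → M) :
    (∑ m ∈ Finset.range (Alexander.collisionCount G ε z t), ∑ i : Fin N, ∑ j : Fin N,
        (if i < j ∧
            freeFlight G (Alexander.freeExitTime G ε (Alexander.stateAfter G ε z m)).toReal
                (Alexander.stateAfter G ε z m) ∈ contactSet G N ε i j ∧
            IsIncoming G (freeFlight G (Alexander.freeExitTime G ε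
                (Alexander.stateAfter G ε z m)).toReal (Alexander.stateAfter G ε z m)) i j
          then f (freeFlight G (Alexander.freeExitTime G ε
                (Alexander.stateAfter G ε z m)).toReal (Alexander.stateAfter G ε z m)) i j
          else 0)) =
      Φ.collisionPairSum (Ioc 0 t)
        (fun _ w i j => if i < j then f (collidePair G i j w) i j else 0) z := by
  have hγ : IsHardSphereTrajectory G ε N fun s => Φ.flow s z := Φ.isTrajectory z hz
  have h0 : Φ.flow 0 z = z := Φ.flow_zero z hz
  have h := hitSum_eq_collisionPairSum hG hγ ht f
  beta_reduce at h
  rw [h0] at h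
  exact h

end Flow

/-! ### Campbell's formula for hit-sums under the homogeneous Gibbs law on `T³` -/

/-- **Campbell's formula for hit-sums under the homogeneous Gibbs law** (binder form).  Assume the
special-flow / Campbell identity `HardSphereCampbellFormula`.  On `T³` with reduced diameter
`0 < σ < 1/2` (so `ε_N = hsDiameter σ N ∈ (0, 1/2)`), for every `N`, every hard-sphere flow structure
`Φ`, every `t ≥ 0` and every measurable mark `F ≥ 0` of (pre-collisional configuration, ordered pair),
the mean under `Q_N = localGibbsLaw σ 1 0 θ N Φ` of the hit-sum
`Σ_{m < collisionCount z t} Σ_{i,j} [hit y_m i j] F (y_m, i, j)` over Alexander's construction equals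
`ofReal t * outgoingCollisionFlux ε_N (N+1) (ρ_N · g)`, with the transported mark
`g (w, i, j) = [i < j] F (collidePair i j w, i, j)` (pre-collisional data read off the outgoing contact
configuration through the elastic involution) and the Gibbs density
`ρ_N = ofReal ∘ canonicalDensity … (localGibbsProfile 1 0 θ)` inserted at the contact configuration
(it is invariant along good orbits, `canonicalDensity_const_flow`, so `HardSphereCampbellFormula.withDensity`
applies; the pathwise bridge `hitSum_eq_collisionPairSum_flow` holds `Q_N`-a.e. since `Q_N ≪ Liouville`).
[cite: CIP1994, App. 4.A pp. 107–111] -/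
theorem lintegral_hitSum_localGibbsLaw_const (hC : HardSphereCampbellFormula) {σ : ℝ} (hσ : 0 < σ)
    (hσh : σ < 1 / 2) (θ : ℝ) (N : ℕ)
    (Φ : HardSphereFlow (Torus.geometry (Fin 3)) (hsDiameter σ N) (N + 1)) {t : ℝ} (ht : 0 ≤ t)
    (F : Config (N + 1) (Fin 3) T3 → Fin (N + 1) → Fin (N + 1) → ℝ≥0∞)
    (hF : ∀ i j, Measurable fun w => F w i j) :
    ∫⁻ z, (∑ m ∈ Finset.range (Alexander.collisionCount (Torus.geometry (Fin 3)) (hsDiameter σ N) z t),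
        ∑ i : Fin (N + 1), ∑ j : Fin (N + 1),
        (if i < j ∧
            freeFlight (Torus.geometry (Fin 3)) (Alexander.freeExitTime (Torus.geometry (Fin 3))
                (hsDiameter σ N) (Alexander.stateAfter (Torus.geometry (Fin 3)) (hsDiameter σ N) z m)).toReal
                (Alexander.stateAfter (Torus.geometry (Fin 3)) (hsDiameter σ N) z m) ∈
              contactSet (Torus.geometry (Fin 3)) (N + 1) (hsDiameter σ N) i j ∧
            IsIncoming (Torus.geometry (Fin 3)) (freeFlight (Torus.geometry (Fin 3))
                (Alexander.freeExitTime (Torus.geometry (Fin 3)) (hsDiameter σ N)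
                  (Alexander.stateAfter (Torus.geometry (Fin 3)) (hsDiameter σ N) z m)).toReal
                (Alexander.stateAfter (Torus.geometry (Fin 3)) (hsDiameter σ N) z m)) i j
          then F (freeFlight (Torus.geometry (Fin 3)) (Alexander.freeExitTime (Torus.geometry (Fin 3))
                (hsDiameter σ N) (Alexander.stateAfter (Torus.geometry (Fin 3)) (hsDiameter σ N) z m)).toReal
                (Alexander.stateAfter (Torus.geometry (Fin 3)) (hsDiameter σ N) z m)) i j
          else 0)) ∂(localGibbsLaw σ (fun _ => 1) (fun _ => 0) (fun _ => θ) N Φ) =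
      ENNReal.ofReal t * outgoingCollisionFlux (hsDiameter σ N) (N + 1) (fun w i j =>
        ENNReal.ofReal (canonicalDensity (Torus.geometry (Fin 3)) (hsDiameter σ N) (N + 1)
          (localGibbsProfile (fun _ => 1) (fun _ => 0) (fun _ => θ)) w) *
        (if i < j then F (collidePair (Torus.geometry (Fin 3)) i j w) i j else 0)) := by
  -- the torus geometry is hard-sphere regular and measurable at this diameter
  have hε0 : 0 < hsDiameter σ N := hsDiameter_pos hσ N
  have hεh : hsDiameter σ N < 1 / 2 := (hsDiameter_le hσ.le N).trans_lt hσh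
  have hG : (Torus.geometry (Fin 3)).IsHardSphereRegular (hsDiameter σ N) :=
    Torus.isHardSphereRegular_geometry (by rw [inv_eq_one_div]; exact hεh)
  have hGm : (Torus.geometry (Fin 3)).IsMeasurable := Torus.isMeasurable_geometry
  -- the Gibbs density: measurable, finite, invariant along good orbits
  set W : Config (N + 1) (Fin 3) T3 → ℝ≥0∞ := fun z =>
    ENNReal.ofReal (canonicalDensity (Torus.geometry (Fin 3)) (hsDiameter σ N) (N + 1)
      (localGibbsProfile (fun _ => 1) (fun _ => 0) (fun _ => θ)) z) with hW
  have hWm : Measurable W :=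
    (measurable_canonicalDensity _ _
      (measurable_localGibbsProfile continuous_const continuous_const continuous_const)).ennreal_ofReal
  have hWinv : ∀ z ∈ Φ.good, ∀ s, W (Φ.flow s z) = W z := by
    intro z hz s
    simp only [hW, canonicalDensity_const_flow 1 θ 0 Φ hz s]
  have hQ : localGibbsLaw σ (fun _ => 1) (fun _ => 0) (fun _ => θ) N Φ =
      (liouville (Torus.geometry (Fin 3)) (N + 1) (hsDiameter σ N)).withDensity W := rfl
  -- the transported mark is measurable
  set g : Config (N + 1) (Fin 3) T3 → Fin (N + 1) → Fin (N + 1) → ℝ≥0∞ := fun w i j =>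
    if i < j then F (collidePair (Torus.geometry (Fin 3)) i j w) i j else 0 with hg
  have hgm : ∀ i j, Measurable fun w => g w i j := by
    intro i j
    by_cases hij : i < j
    · simp only [hg, if_pos hij]
      exact (hF i j).comp (hGm.measurable_collidePair i j)
    · simp only [hg, if_neg hij]
      exact measurable_const
  -- Campbell under the (invariant-density) Gibbs law, then the pathwise bridge a.e.
  have hC' := hC.withDensity hε0 hεh Φ hWm (fun _ => ENNReal.ofReal_ne_top) hWinv hgm t
  rw [hQ]
  refine Eq.trans (lintegral_congr_ae ?_) hC'
  have hae : ∀ᵐ z ∂(liouville (Torus.geometry (Fin 3)) (N + 1) (hsDiameter σ N)).withDensity W,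
      z ∈ Φ.good :=
    (withDensity_absolutelyContinuous _ _).ae_le Φ.ae_mem_good
  filter_upwards [hae] with z hz
  exact hitSum_eq_collisionPairSum_flow hG Φ hz ht F

/-- **Registered sub-goal `stub_costCampbellHitSum` of stub `stub_cost`** (line `Sketch`, crux
ContactAngleEquidistribution, stmt-AtomisticToContinuum-12097): CAMPBELL FOR HIT-SUMS, in the crux's
`let`-encoding.  Conditional on the named fact `HardSphereCampbellFormula`: for the torus geometry,
`0 < σ < 1/2`, every `θe`, every `N`, every hard-sphere flow structure `Φ`, every `t ≥ 0` and every
measurable `ℝ≥0∞`-valued mark `F` read on the pre-collisional configuration and the `hit`-selected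
ordered pair,
`∫⁻ Σ_{m < Kt z t} Σ_i Σ_j [hit (zpre z m) i j] F (zpre z m) i j ∂Q_N
   = ofReal t * outgoingCollisionFlux (ε σ N) (N+1) (fun w i j => ρ_N w * [i < j] F (collidePair i j w) i j)`,
`ρ_N = ofReal ∘ canonicalDensity G (ε σ N) (N+1) (localGibbsProfile 1 0 θe)` the density of
`Q_N = localGibbsLaw σ 1 0 θe N Φ` with respect to the Liouville measure (`= lintegral_hitSum_localGibbsLaw_const`).
[cite: CIP1994, App. 4.A pp. 107–111] -/
theorem stub_costCampbellHitSum (hC : HardSphereCampbellFormula) :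
    let Cfg : ℕ → Type := fun N => Config (N + 1) (Fin 3) T3
    let G := Torus.geometry (Fin 3)
    let ε : ℝ → ℕ → ℝ := hsDiameter
    let τ : ℝ → (N : ℕ) → Cfg N → ℝ≥0∞ := fun σ N z => Alexander.freeExitTime G (ε σ N) z
    let S : ℝ → (N : ℕ) → Cfg N → Cfg N := fun t _ z => freeFlight G t z
    let zpre : ℝ → (N : ℕ) → Cfg N → ℕ → Cfg N := fun σ N z m =>
      let y := Alexander.stateAfter G (ε σ N) z m; S (τ σ N y).toReal N y
    let Kt : ℝ → (N : ℕ) → Cfg N → ℝ → ℕ := fun σ N z t => Alexander.collisionCount G (ε σ N) z t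
    let hit : ℝ → (N : ℕ) → Cfg N → Fin (N + 1) → Fin (N + 1) → Prop := fun σ N y i j =>
      i < j ∧ y ∈ contactSet G (N + 1) (ε σ N) i j ∧ IsIncoming G y i j
    ∀ σ : ℝ, 0 < σ → σ < 1 / 2 → ∀ (θe : ℝ) (N : ℕ) (Φ : HardSphereFlow G (ε σ N) (N + 1)),
      let Q := localGibbsLaw σ (fun _ => 1) (fun _ => 0) (fun _ => θe) N Φ
      ∀ t : ℝ, 0 ≤ t → ∀ F : Cfg N → Fin (N + 1) → Fin (N + 1) → ℝ≥0∞,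
        (∀ i j, Measurable fun w => F w i j) →
        ∫⁻ z, (∑ m ∈ Finset.range (Kt σ N z t), ∑ i : Fin (N + 1), ∑ j : Fin (N + 1),
            (let y := zpre σ N z m
             if hit σ N y i j then F y i j else 0)) ∂Q =
          ENNReal.ofReal t * outgoingCollisionFlux (ε σ N) (N + 1) (fun w i j =>
            ENNReal.ofReal (canonicalDensity G (ε σ N) (N + 1)
              (localGibbsProfile (fun _ => 1) (fun _ => 0) (fun _ => θe)) w) *
            (if i < j then F (collidePair G i j w) i j else 0)) := by
  intro Cfg G ε τ S zpre Kt hit σ hσ hσh θe N Φ Q t ht F hF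
  exact lintegral_hitSum_localGibbsLaw_const hC hσ hσh θe N Φ ht F hF

end Summit.AtomisticToContinuum.HydrodynamicLimit.Theorems.ContactAngleEquidistributionSketch

end
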